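import Mathlib
import Summits.Ventures.PercRepro2.Defs
import Summits.Ventures.PercRepro2.Independence
import Summits.Ventures.PercRepro2.Harris
import Summits.Ventures.PercRepro2.Graph
import Summits.Ventures.PercRepro2.Exploration
import Summits.Ventures.PercRepro2.Events
import Summits.Ventures.PercRepro2.Induced
import Summits.Ventures.PercRepro2.BHK
import Summits.Ventures.PercRepro2.BHKEvents
import Summits.Ventures.PercRepro2.RBRoot
import Summits.Ventures.PercRepro2.RBDefs
import Summits.Ventures.PercRepro2.RBClubDefs

/-!
# Candidate row 2′RB-CLUB: the cleared form, and the two-marker polynomial certificate (blind cell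
PercRepro2, mine-a g8; MINE-A.md §48–§49, proofs/MINEA-CLUB.md §7)

* `club_of_cleared` (every graph): `RB.Club` follows from the CLEARED cubic
  `P(Q∩M∩bL∩oL)·P(Q)·P(Q∩Mᶜ) + P(Q∩Mᶜ∩bL)·P(Q∩Mᶜ∩oL)·P(Q) − P(Q∩bL)·P(Q∩oL)·P(Q∩Mᶜ) ≥ 0`
  (`M = {s ↔ w}`); the degenerate cases `P(Q) = 0` and `P(Q ∩ Mᶜ) = 0` (then `w ∈ C_s` a.s. under
  `Q` and the coarse row is BHK 1.3 with the up-sets `{b, w ∈ C_s}`, `{o, w ∈ C_s}`) are handled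
  separately.
* `clubPoly` / `clubPoly_nonneg`: the cleared cubic of a third vertex whose only edges go to the two
  markers, written in the core masses of `G − w` (`Z = P(Q)`, `A = P(Q ∩ bL)`, `C = P(Q ∩ oL)`,
  `J = P(Q ∩ bL ∩ oL)`, `H = P(Q ∩ bL ∩ oH)`, `K = P(Q ∩ oL ∩ bH)`) and the marker-edge weights
  `π, ρ`, is `Δ · P₁ + Rest` with `Δ = J·Z − A·C` (BHK 1.3 of `G − w`) and `P₁` (24 terms), `Rest`
  (166 terms) polynomials with nonnegative integer coefficients in the type masses
  `J, A − J − H, C − J − K, H, K, Z − A − C + J` and the Bernstein monomials of `π, ρ` — the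
  certificate of MINE-A.md §48 (found by mine-a g7, re-derived independently by g8), checked here
  by `ring` and `positivity`.
-/

namespace Summit.Ventures.PercRepro2

namespace RBClubPoly

open scoped Classical

section Cleared

variable {V : Type*} {E : Type*} [Fintype E] [DecidableEq E] [Fintype V] {R : Type*} [Field R]
  [LinearOrder R] [IsStrictOrderedRing R] (ends : E → Sym2 V) {p : E → R}

/-- **BHK 1.3 with the third vertex attached**: `P(Q ∩ M ∩ bL) P(Q ∩ M ∩ oL) ≤ P(Q ∩ M ∩ bL ∩ oL) P(Q)`
(`M = {s ↔ w}`; the up-sets `{A | b ∈ A ∧ w ∈ A}`, `{A | o ∈ A ∧ w ∈ A}` of `C_s`). -/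
lemma bhk_same_with_mem (hp : IsProbVec p) (o b s t w : V) :
    prob p ((connEvent ends s t)ᶜ ∩ connEvent ends s w ∩ connEvent ends b s) *
        prob p ((connEvent ends s t)ᶜ ∩ connEvent ends s w ∩ connEvent ends o s) ≤
      prob p ((connEvent ends s t)ᶜ ∩ connEvent ends s w ∩ connEvent ends b s ∩ connEvent ends o s) *
        prob p (connEvent ends s t)ᶜ := by
  have hU : IsUpperSet {A : Set V | b ∈ A ∧ w ∈ A} := fun _ _ h ⟨hb, hw⟩ => ⟨h hb, h hw⟩
  have hV : IsUpperSet {A : Set V | o ∈ A ∧ w ∈ A} := fun _ _ h ⟨ho, hw⟩ => ⟨h ho, h hw⟩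
  have key := bhk_same_cluster_events p hp ends s t hU hV
  have e1 : clusterInEvent ends s {A : Set V | b ∈ A ∧ w ∈ A} ∩ (connEvent ends s t)ᶜ =
      (connEvent ends s t)ᶜ ∩ connEvent ends s w ∩ connEvent ends b s := by
    ext ω
    simp only [Set.mem_inter_iff, mem_clusterInEvent, Set.mem_setOf_eq, mem_cluster, mem_connEvent]
    constructor
    · rintro ⟨⟨hb, hw⟩, hQ⟩; exact ⟨⟨hQ, hw⟩, conn_symm hb⟩
    · rintro ⟨⟨hQ, hw⟩, hb⟩; exact ⟨⟨conn_symm hb, hw⟩, hQ⟩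
  have e2 : clusterInEvent ends s {A : Set V | o ∈ A ∧ w ∈ A} ∩ (connEvent ends s t)ᶜ =
      (connEvent ends s t)ᶜ ∩ connEvent ends s w ∩ connEvent ends o s := by
    ext ω
    simp only [Set.mem_inter_iff, mem_clusterInEvent, Set.mem_setOf_eq, mem_cluster, mem_connEvent]
    constructor
    · rintro ⟨⟨ho, hw⟩, hQ⟩; exact ⟨⟨hQ, hw⟩, conn_symm ho⟩
    · rintro ⟨⟨hQ, hw⟩, ho⟩; exact ⟨⟨conn_symm ho, hw⟩, hQ⟩
  have e3 : clusterInEvent ends s {A : Set V | b ∈ A ∧ w ∈ A} ∩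
      clusterInEvent ends s {A : Set V | o ∈ A ∧ w ∈ A} ∩ (connEvent ends s t)ᶜ =
      (connEvent ends s t)ᶜ ∩ connEvent ends s w ∩ connEvent ends b s ∩ connEvent ends o s := by
    ext ω
    simp only [Set.mem_inter_iff, mem_clusterInEvent, Set.mem_setOf_eq, mem_cluster, mem_connEvent]
    constructor
    · rintro ⟨⟨⟨hb, hw⟩, ⟨ho, _⟩⟩, hQ⟩; exact ⟨⟨⟨hQ, hw⟩, conn_symm hb⟩, conn_symm ho⟩
    · rintro ⟨⟨⟨hQ, hw⟩, hb⟩, ho⟩; exact ⟨⟨⟨conn_symm hb, hw⟩, ⟨conn_symm ho, hw⟩⟩, hQ⟩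
  rw [e1, e2, e3] at key
  exact key

/-- **The coarse row from its cleared form** (every graph, every third vertex): with
`Z = P(Q)`, `D = P(Q ∩ Mᶜ)`, `RB.Club` follows from
`P(Q∩M∩bL∩oL)·Z·D + P(Q∩Mᶜ∩bL)·P(Q∩Mᶜ∩oL)·Z − P(Q∩bL)·P(Q∩oL)·D ≥ 0`. -/
theorem club_of_cleared (hp : IsProbVec p) (o b s t w : V)
    (hP : 0 ≤ prob p ((connEvent ends s t)ᶜ ∩ connEvent ends s w ∩ connEvent ends b s ∩
          connEvent ends o s) * prob p (connEvent ends s t)ᶜ *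
          prob p ((connEvent ends s t)ᶜ ∩ (connEvent ends s w)ᶜ) +
        prob p ((connEvent ends s t)ᶜ ∩ (connEvent ends s w)ᶜ ∩ connEvent ends b s) *
          prob p ((connEvent ends s t)ᶜ ∩ (connEvent ends s w)ᶜ ∩ connEvent ends o s) *
          prob p (connEvent ends s t)ᶜ -
        prob p ((connEvent ends s t)ᶜ ∩ connEvent ends b s) *
          prob p ((connEvent ends s t)ᶜ ∩ connEvent ends o s) *
          prob p ((connEvent ends s t)ᶜ ∩ (connEvent ends s w)ᶜ)) :
    RB.Club p ends o b s t w := by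
  unfold RB.Club RB.Qst
  set Q := (connEvent ends s t)ᶜ with hQ
  set M := connEvent ends s w with hM
  set bL := connEvent ends b s with hbL
  set oL := connEvent ends o s with hoL
  have hZ0 : 0 ≤ prob p Q := prob_nonneg hp _
  have hB0 : 0 ≤ prob p (Q ∩ bL) := prob_nonneg hp _
  have hBZ : prob p (Q ∩ bL) ≤ prob p Q := prob_mono hp Set.inter_subset_left
  have hO0 : 0 ≤ prob p (Q ∩ oL) := prob_nonneg hp _
  have hMBO0 : 0 ≤ prob p (Q ∩ M ∩ bL ∩ oL) := prob_nonneg hp _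
  have hD0 : 0 ≤ prob p (Q ∩ Mᶜ) := prob_nonneg hp _
  have hnMB0 : 0 ≤ prob p (Q ∩ Mᶜ ∩ bL) := prob_nonneg hp _
  have hnMBD : prob p (Q ∩ Mᶜ ∩ bL) ≤ prob p (Q ∩ Mᶜ) := prob_mono hp Set.inter_subset_left
  have hnMO0 : 0 ≤ prob p (Q ∩ Mᶜ ∩ oL) := prob_nonneg hp _
  have hrhs0 : 0 ≤ prob p (Q ∩ Mᶜ ∩ bL) * prob p (Q ∩ Mᶜ ∩ oL) / prob p (Q ∩ Mᶜ) :=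
    div_nonneg (mul_nonneg hnMB0 hnMO0) hD0
  rcases eq_or_lt_of_le hZ0 with hZ | hZ
  · -- `P(Q) = 0`: the left-hand side is `0 / 0 = 0`
    rw [← hZ, div_zero]
    exact add_nonneg hMBO0 hrhs0
  rcases eq_or_lt_of_le hD0 with hD | hD
  · -- `P(Q ∩ Mᶜ) = 0`: `w ∈ C_s` a.s. under `Q`, the coarse row is BHK 1.3 with `w` attached
    have hnMB : prob p (Q ∩ Mᶜ ∩ bL) = 0 := le_antisymm (hD ▸ hnMBD) hnMB0
    have hnMO : prob p (Q ∩ Mᶜ ∩ oL) = 0 :=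
      le_antisymm (hD ▸ prob_mono hp Set.inter_subset_left) hnMO0
    have hB : prob p (Q ∩ bL) = prob p (Q ∩ M ∩ bL) := by
      have := prob_inter_add_prob_inter_compl p (Q ∩ bL) M
      rw [Set.inter_right_comm, Set.inter_right_comm Q bL Mᶜ, hnMB, add_zero] at this
      exact this.symm
    have hO : prob p (Q ∩ oL) = prob p (Q ∩ M ∩ oL) := by
      have := prob_inter_add_prob_inter_compl p (Q ∩ oL) M
      rw [Set.inter_right_comm, Set.inter_right_comm Q oL Mᶜ, hnMO, add_zero] at this
      exact this.symm
    rw [hnMB, zero_mul, zero_div, add_zero, hB, hO, div_le_iff₀ hZ]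
    exact bhk_same_with_mem ends hp o b s t w
  -- both denominators positive: clear them
  have hrhs : prob p (Q ∩ M ∩ bL ∩ oL) + prob p (Q ∩ Mᶜ ∩ bL) * prob p (Q ∩ Mᶜ ∩ oL) / prob p (Q ∩ Mᶜ) =
      (prob p (Q ∩ M ∩ bL ∩ oL) * prob p (Q ∩ Mᶜ) + prob p (Q ∩ Mᶜ ∩ bL) * prob p (Q ∩ Mᶜ ∩ oL)) /
        prob p (Q ∩ Mᶜ) := by
    field_simp
  rw [hrhs, div_le_div_iff₀ hZ hD]
  nlinarith [hP]

end Cleared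

section Poly

variable {R : Type*} [Field R] [LinearOrder R] [IsStrictOrderedRing R]

/-- The cleared coarse row of a third vertex adjacent only to the two markers, in the core masses
of `G − w` and the marker-edge weights `π = p{w,b}`, `ρ = p{w,o}`: every mass is the mixture over
the four patterns (both open: `Q` loses the masses `H, K`, and `{w, b, o ∈ C_s} = {b ∈ C_s or
o ∈ C_s}` has mass `X = A + C − J − H − K`; `{w,b}` open only: `M = bL`; `{w,o}` open only:
`M = oL`; both closed: `w` isolated). -/
noncomputable def clubPoly (Z A C J H K π ρ : R) : R :=
  (ρ * (π * (A + C - J - H - K) + (1 - π) * J) + (1 - ρ) * (π * J + (1 - π) * 0)) *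
      (ρ * (π * (Z - H - K) + (1 - π) * Z) + (1 - ρ) * (π * Z + (1 - π) * Z)) *
      (ρ * (π * (Z - A - C + J) + (1 - π) * (Z - C)) + (1 - ρ) * (π * (Z - A) + (1 - π) * Z)) +
    (ρ * (π * 0 + (1 - π) * (A - J)) + (1 - ρ) * (π * 0 + (1 - π) * A)) *
      (ρ * (π * 0 + (1 - π) * 0) + (1 - ρ) * (π * (C - J) + (1 - π) * C)) *
      (ρ * (π * (Z - H - K) + (1 - π) * Z) + (1 - ρ) * (π * Z + (1 - π) * Z)) -
    (ρ * (π * (A + C - J - H - K) + (1 - π) * A) + (1 - ρ) * (π * A + (1 - π) * A)) *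
      (ρ * (π * (A + C - J - H - K) + (1 - π) * C) + (1 - ρ) * (π * C + (1 - π) * C)) *
      (ρ * (π * (Z - A - C + J) + (1 - π) * (Z - C)) + (1 - ρ) * (π * (Z - A) + (1 - π) * Z))

/-- The first certificate polynomial `P₁` (24 terms, MINE-A.md §48) in the type masses of `G − w`
and the Bernstein letters `π, π' = 1 − π, ρ, ρ' = 1 − ρ`. -/
noncomputable def certP1 (l n H K r π π' ρ ρ' : R) : R :=
      r * π' * π' * ρ * ρ' + r * π' * π' * ρ * ρ + r * π * π' * ρ' * ρ' +
      3 * r * π * π' * ρ * ρ' + 2 * r * π * π' * ρ * ρ + r * π * π * ρ' * ρ' +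
      2 * r * π * π * ρ * ρ' + r * π * π * ρ * ρ + K * π * π' * ρ' * ρ' +
      2 * K * π * π' * ρ * ρ' + K * π * π * ρ' * ρ' + K * π * π * ρ * ρ' + H * π' * π' * ρ * ρ' +
      H * π' * π' * ρ * ρ + 2 * H * π * π' * ρ * ρ' + H * π * π' * ρ * ρ + n * π * π' * ρ' * ρ' +
      2 * n * π * π' * ρ * ρ' + n * π * π * ρ' * ρ' + n * π * π * ρ * ρ' + l * π' * π' * ρ * ρ' +
      l * π' * π' * ρ * ρ + 2 * l * π * π' * ρ * ρ' + l * π * π' * ρ * ρ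

/-- `certP1 ≥ 0` for nonnegative letters (every coefficient is a nonnegative integer). -/
lemma certP1_nonneg {l n H K r π π' ρ ρ' : R} (hl : 0 ≤ l) (hn : 0 ≤ n) (hH : 0 ≤ H) (hK : 0 ≤ K) (hr : 0 ≤ r) (hπ : 0 ≤ π) (hπ' : 0 ≤ π') (hρ : 0 ≤ ρ) (hρ' : 0 ≤ ρ') :
    0 ≤ certP1 l n H K r π π' ρ ρ' := by
  unfold certP1
  positivity

/-- Part 1 of 3 of the remainder polynomial `Rest` (166 terms in all, MINE-A.md §48). -/
noncomputable def certRest1 (n H K r π π' ρ ρ' : R) : R :=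
      2 * H * K * r * π * π' * π' * ρ * ρ' * ρ' + 4 * H * K * r * π * π' * π' * ρ * ρ * ρ' +
      2 * H * K * r * π * π' * π' * ρ * ρ * ρ + 4 * H * K * r * π * π * π' * ρ * ρ' * ρ' +
      7 * H * K * r * π * π * π' * ρ * ρ * ρ' + 3 * H * K * r * π * π * π' * ρ * ρ * ρ +
      2 * H * K * r * π * π * π * ρ * ρ' * ρ' + 3 * H * K * r * π * π * π * ρ * ρ * ρ' +
      H * K * r * π * π * π * ρ * ρ * ρ + 2 * H * K * K * π * π' * π' * ρ * ρ' * ρ' +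
      2 * H * K * K * π * π' * π' * ρ * ρ * ρ' + 4 * H * K * K * π * π * π' * ρ * ρ' * ρ' +
      3 * H * K * K * π * π * π' * ρ * ρ * ρ' + 2 * H * K * K * π * π * π * ρ * ρ' * ρ' +
      H * K * K * π * π * π * ρ * ρ * ρ' + 2 * H * H * K * π * π' * π' * ρ * ρ' * ρ' +
      4 * H * H * K * π * π' * π' * ρ * ρ * ρ' + 2 * H * H * K * π * π' * π' * ρ * ρ * ρ +
      2 * H * H * K * π * π * π' * ρ * ρ' * ρ' + 3 * H * H * K * π * π * π' * ρ * ρ * ρ' +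
      H * H * K * π * π * π' * ρ * ρ * ρ + n * r * r * π * π' * π' * ρ * ρ' * ρ' +
      2 * n * r * r * π * π' * π' * ρ * ρ * ρ' + n * r * r * π * π' * π' * ρ * ρ * ρ +
      2 * n * r * r * π * π * π' * ρ * ρ' * ρ' + 4 * n * r * r * π * π * π' * ρ * ρ * ρ' +
      2 * n * r * r * π * π * π' * ρ * ρ * ρ + n * r * r * π * π * π * ρ * ρ' * ρ' +
      2 * n * r * r * π * π * π * ρ * ρ * ρ' + n * r * r * π * π * π * ρ * ρ * ρ +
      n * K * r * π * π' * π' * ρ * ρ' * ρ' + n * K * r * π * π' * π' * ρ * ρ * ρ' +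
      2 * n * K * r * π * π * π' * ρ * ρ' * ρ' + 2 * n * K * r * π * π * π' * ρ * ρ * ρ' +
      n * K * r * π * π * π * ρ * ρ' * ρ' + n * K * r * π * π * π * ρ * ρ * ρ' +
      3 * n * H * r * π * π' * π' * ρ * ρ' * ρ' + 6 * n * H * r * π * π' * π' * ρ * ρ * ρ' +
      3 * n * H * r * π * π' * π' * ρ * ρ * ρ + 5 * n * H * r * π * π * π' * ρ * ρ' * ρ' +
      9 * n * H * r * π * π * π' * ρ * ρ * ρ' + 4 * n * H * r * π * π * π' * ρ * ρ * ρ +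
      2 * n * H * r * π * π * π * ρ * ρ' * ρ' + 3 * n * H * r * π * π * π * ρ * ρ * ρ' +
      n * H * r * π * π * π * ρ * ρ * ρ + 5 * n * H * K * π * π' * π' * ρ * ρ' * ρ' +
      5 * n * H * K * π * π' * π' * ρ * ρ * ρ' + 9 * n * H * K * π * π * π' * ρ * ρ' * ρ' +
      7 * n * H * K * π * π * π' * ρ * ρ * ρ' + 4 * n * H * K * π * π * π * ρ * ρ' * ρ' +
      2 * n * H * K * π * π * π * ρ * ρ * ρ' + 2 * n * H * H * π * π' * π' * ρ * ρ' * ρ' +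
      4 * n * H * H * π * π' * π' * ρ * ρ * ρ' + 2 * n * H * H * π * π' * π' * ρ * ρ * ρ +
      2 * n * H * H * π * π * π' * ρ * ρ' * ρ'

/-- `certRest1 ≥ 0` for nonnegative letters (every coefficient is a nonnegative integer). -/
lemma certRest1_nonneg {n H K r π π' ρ ρ' : R} (hn : 0 ≤ n) (hH : 0 ≤ H) (hK : 0 ≤ K) (hr : 0 ≤ r) (hπ : 0 ≤ π) (hπ' : 0 ≤ π') (hρ : 0 ≤ ρ) (hρ' : 0 ≤ ρ') :
    0 ≤ certRest1 n H K r π π' ρ ρ' := by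
  unfold certRest1
  positivity

/-- Part 2 of 3 of the remainder polynomial `Rest` (166 terms in all, MINE-A.md §48). -/
noncomputable def certRest2 (l n H K r π π' ρ ρ' : R) : R :=
      3 * n * H * H * π * π * π' * ρ * ρ * ρ' + n * H * H * π * π * π' * ρ * ρ * ρ +
      n * n * r * π * π' * π' * ρ * ρ' * ρ' + n * n * r * π * π' * π' * ρ * ρ * ρ' +
      2 * n * n * r * π * π * π' * ρ * ρ' * ρ' + 2 * n * n * r * π * π * π' * ρ * ρ * ρ' +
      n * n * r * π * π * π * ρ * ρ' * ρ' + n * n * r * π * π * π * ρ * ρ * ρ' +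
      3 * n * n * H * π * π' * π' * ρ * ρ' * ρ' + 3 * n * n * H * π * π' * π' * ρ * ρ * ρ' +
      5 * n * n * H * π * π * π' * ρ * ρ' * ρ' + 4 * n * n * H * π * π * π' * ρ * ρ * ρ' +
      2 * n * n * H * π * π * π * ρ * ρ' * ρ' + n * n * H * π * π * π * ρ * ρ * ρ' +
      l * r * r * π * π' * π' * ρ * ρ' * ρ' + 2 * l * r * r * π * π' * π' * ρ * ρ * ρ' +
      l * r * r * π * π' * π' * ρ * ρ * ρ + 2 * l * r * r * π * π * π' * ρ * ρ' * ρ' +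
      4 * l * r * r * π * π * π' * ρ * ρ * ρ' + 2 * l * r * r * π * π * π' * ρ * ρ * ρ +
      l * r * r * π * π * π * ρ * ρ' * ρ' + 2 * l * r * r * π * π * π * ρ * ρ * ρ' +
      l * r * r * π * π * π * ρ * ρ * ρ + 3 * l * K * r * π * π' * π' * ρ * ρ' * ρ' +
      5 * l * K * r * π * π' * π' * ρ * ρ * ρ' + 2 * l * K * r * π * π' * π' * ρ * ρ * ρ +
      6 * l * K * r * π * π * π' * ρ * ρ' * ρ' + 9 * l * K * r * π * π * π' * ρ * ρ * ρ' +
      3 * l * K * r * π * π * π' * ρ * ρ * ρ + 3 * l * K * r * π * π * π * ρ * ρ' * ρ' +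
      4 * l * K * r * π * π * π * ρ * ρ * ρ' + l * K * r * π * π * π * ρ * ρ * ρ +
      2 * l * K * K * π * π' * π' * ρ * ρ' * ρ' + 2 * l * K * K * π * π' * π' * ρ * ρ * ρ' +
      4 * l * K * K * π * π * π' * ρ * ρ' * ρ' + 3 * l * K * K * π * π * π' * ρ * ρ * ρ' +
      2 * l * K * K * π * π * π * ρ * ρ' * ρ' + l * K * K * π * π * π * ρ * ρ * ρ' +
      l * H * r * π * π' * π' * ρ * ρ' * ρ' + 2 * l * H * r * π * π' * π' * ρ * ρ * ρ' +
      l * H * r * π * π' * π' * ρ * ρ * ρ + l * H * r * π * π * π' * ρ * ρ' * ρ' +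
      2 * l * H * r * π * π * π' * ρ * ρ * ρ' + l * H * r * π * π * π' * ρ * ρ * ρ +
      5 * l * H * K * π * π' * π' * ρ * ρ' * ρ' + 9 * l * H * K * π * π' * π' * ρ * ρ * ρ' +
      4 * l * H * K * π * π' * π' * ρ * ρ * ρ + 5 * l * H * K * π * π * π' * ρ * ρ' * ρ' +
      7 * l * H * K * π * π * π' * ρ * ρ * ρ' + 2 * l * H * K * π * π * π' * ρ * ρ * ρ +
      4 * l * n * r * π * π' * π' * ρ * ρ' * ρ' + 7 * l * n * r * π * π' * π' * ρ * ρ * ρ' +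
      3 * l * n * r * π * π' * π' * ρ * ρ * ρ + 7 * l * n * r * π * π * π' * ρ * ρ' * ρ' +
      11 * l * n * r * π * π * π' * ρ * ρ * ρ'

/-- `certRest2 ≥ 0` for nonnegative letters (every coefficient is a nonnegative integer). -/
lemma certRest2_nonneg {l n H K r π π' ρ ρ' : R} (hl : 0 ≤ l) (hn : 0 ≤ n) (hH : 0 ≤ H) (hK : 0 ≤ K) (hr : 0 ≤ r) (hπ : 0 ≤ π) (hπ' : 0 ≤ π') (hρ : 0 ≤ ρ) (hρ' : 0 ≤ ρ') :
    0 ≤ certRest2 l n H K r π π' ρ ρ' := by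
  unfold certRest2
  positivity

/-- Part 3 of 3 of the remainder polynomial `Rest` (166 terms in all, MINE-A.md §48). -/
noncomputable def certRest3 (J l n H K r π π' ρ ρ' : R) : R :=
      4 * l * n * r * π * π * π' * ρ * ρ * ρ + 3 * l * n * r * π * π * π * ρ * ρ' * ρ' +
      4 * l * n * r * π * π * π * ρ * ρ * ρ' + l * n * r * π * π * π * ρ * ρ * ρ +
      5 * l * n * K * π * π' * π' * ρ * ρ' * ρ' + 5 * l * n * K * π * π' * π' * ρ * ρ * ρ' +
      9 * l * n * K * π * π * π' * ρ * ρ' * ρ' + 7 * l * n * K * π * π * π' * ρ * ρ * ρ' +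
      4 * l * n * K * π * π * π * ρ * ρ' * ρ' + 2 * l * n * K * π * π * π * ρ * ρ * ρ' +
      5 * l * n * H * π * π' * π' * ρ * ρ' * ρ' + 9 * l * n * H * π * π' * π' * ρ * ρ * ρ' +
      4 * l * n * H * π * π' * π' * ρ * ρ * ρ + 5 * l * n * H * π * π * π' * ρ * ρ' * ρ' +
      7 * l * n * H * π * π * π' * ρ * ρ * ρ' + 2 * l * n * H * π * π * π' * ρ * ρ * ρ +
      3 * l * n * n * π * π' * π' * ρ * ρ' * ρ' + 3 * l * n * n * π * π' * π' * ρ * ρ * ρ' +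
      5 * l * n * n * π * π * π' * ρ * ρ' * ρ' + 4 * l * n * n * π * π * π' * ρ * ρ * ρ' +
      2 * l * n * n * π * π * π * ρ * ρ' * ρ' + l * n * n * π * π * π * ρ * ρ * ρ' +
      l * l * r * π * π' * π' * ρ * ρ' * ρ' + 2 * l * l * r * π * π' * π' * ρ * ρ * ρ' +
      l * l * r * π * π' * π' * ρ * ρ * ρ + l * l * r * π * π * π' * ρ * ρ' * ρ' +
      2 * l * l * r * π * π * π' * ρ * ρ * ρ' + l * l * r * π * π * π' * ρ * ρ * ρ +
      3 * l * l * K * π * π' * π' * ρ * ρ' * ρ' + 5 * l * l * K * π * π' * π' * ρ * ρ * ρ' +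
      2 * l * l * K * π * π' * π' * ρ * ρ * ρ + 3 * l * l * K * π * π * π' * ρ * ρ' * ρ' +
      4 * l * l * K * π * π * π' * ρ * ρ * ρ' + l * l * K * π * π * π' * ρ * ρ * ρ +
      3 * l * l * n * π * π' * π' * ρ * ρ' * ρ' + 5 * l * l * n * π * π' * π' * ρ * ρ * ρ' +
      2 * l * l * n * π * π' * π' * ρ * ρ * ρ + 3 * l * l * n * π * π * π' * ρ * ρ' * ρ' +
      4 * l * l * n * π * π * π' * ρ * ρ * ρ' + l * l * n * π * π * π' * ρ * ρ * ρ +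
      2 * J * H * K * π * π' * π' * ρ * ρ' * ρ' + 2 * J * H * K * π * π' * π' * ρ * ρ * ρ' +
      2 * J * H * K * π * π * π' * ρ * ρ' * ρ' + J * H * K * π * π * π' * ρ * ρ * ρ' +
      2 * J * n * H * π * π' * π' * ρ * ρ' * ρ' + 2 * J * n * H * π * π' * π' * ρ * ρ * ρ' +
      2 * J * n * H * π * π * π' * ρ * ρ' * ρ' + J * n * H * π * π * π' * ρ * ρ * ρ' +
      2 * J * l * K * π * π' * π' * ρ * ρ' * ρ' + 2 * J * l * K * π * π' * π' * ρ * ρ * ρ' +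
      2 * J * l * K * π * π * π' * ρ * ρ' * ρ' + J * l * K * π * π * π' * ρ * ρ * ρ' +
      2 * J * l * n * π * π' * π' * ρ * ρ' * ρ' + 2 * J * l * n * π * π' * π' * ρ * ρ * ρ' +
      2 * J * l * n * π * π * π' * ρ * ρ' * ρ' + J * l * n * π * π * π' * ρ * ρ * ρ'

/-- `certRest3 ≥ 0` for nonnegative letters (every coefficient is a nonnegative integer). -/
lemma certRest3_nonneg {J l n H K r π π' ρ ρ' : R} (hJ : 0 ≤ J) (hl : 0 ≤ l) (hn : 0 ≤ n) (hH : 0 ≤ H) (hK : 0 ≤ K) (hr : 0 ≤ r) (hπ : 0 ≤ π) (hπ' : 0 ≤ π') (hρ : 0 ≤ ρ) (hρ' : 0 ≤ ρ') :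
    0 ≤ certRest3 J l n H K r π π' ρ ρ' := by
  unfold certRest3
  positivity

omit [LinearOrder R] [IsStrictOrderedRing R] in
/-- **The two-marker certificate identity** (MINE-A.md §48):
`clubPoly = Δ · P₁ + Rest` with `Δ = J·Z − A·C` (BHK 1.3 of `G − w`), the type masses
`l = A − J − H`, `n = C − J − K`, `r = Z − A − C + J` and the letters `π' = 1 − π`, `ρ' = 1 − ρ`. -/
theorem clubPoly_eq (Z A C J H K π ρ : R) :
    clubPoly Z A C J H K π ρ =
      (J * Z - A * C) * certP1 (A - J - H) (C - J - K) H K (Z - A - C + J) π (1 - π) ρ (1 - ρ) +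
        (certRest1 (C - J - K) H K (Z - A - C + J) π (1 - π) ρ (1 - ρ) +
          certRest2 (A - J - H) (C - J - K) H K (Z - A - C + J) π (1 - π) ρ (1 - ρ) +
          certRest3 J (A - J - H) (C - J - K) H K (Z - A - C + J) π (1 - π) ρ (1 - ρ)) := by
  unfold clubPoly certP1 certRest1 certRest2 certRest3
  ring

/-- **The two-marker certificate**: `clubPoly ≥ 0` whenever the type masses are nonnegative,
`Δ = J·Z − A·C ≥ 0` and `π, ρ ∈ [0, 1]`. -/
theorem clubPoly_nonneg {Z A C J H K π ρ : R} (hJ : 0 ≤ J) (hH : 0 ≤ H) (hK : 0 ≤ K)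
    (hl : 0 ≤ A - J - H) (hn : 0 ≤ C - J - K) (hr : 0 ≤ Z - A - C + J) (hΔ : 0 ≤ J * Z - A * C)
    (hπ0 : 0 ≤ π) (hπ1 : π ≤ 1) (hρ0 : 0 ≤ ρ) (hρ1 : ρ ≤ 1) :
    0 ≤ clubPoly Z A C J H K π ρ := by
  have hπ' : 0 ≤ 1 - π := sub_nonneg.2 hπ1
  have hρ' : 0 ≤ 1 - ρ := sub_nonneg.2 hρ1
  rw [clubPoly_eq]
  exact add_nonneg (mul_nonneg hΔ (certP1_nonneg hl hn hH hK hr hπ0 hπ' hρ0 hρ'))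
    (add_nonneg (add_nonneg (certRest1_nonneg hn hH hK hr hπ0 hπ' hρ0 hρ')
      (certRest2_nonneg hl hn hH hK hr hπ0 hπ' hρ0 hρ'))
      (certRest3_nonneg hJ hl hn hH hK hr hπ0 hπ' hρ0 hρ'))

end Poly

end RBClubPoly

end Summit.Ventures.PercRepro2
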